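import Mathlib

/-!
# Route BarrierLever — item 22038 `ChowBenchmarkPairs`, line `moore-peel`: the TWO-SIDED leading-term lemma
# («potentials») for one-parameter degenerations — the certificate format of multi-point coordinate splits

Helper file (`--supports stmt-ValiantsHypothesis-22038`; cell valiant-natproofs, rung V4; seat val-np-p4 gen 23).  Closes NO item;
definition-free; pure linear algebra over `R[X]` for a domain `R`.

A multi-point coordinate split (memo HOME/val-np-p4/g23/; engine `…ChowBenchmarkPairsSplit.lean`) degenerates one coordinate of ALL
points, `P_{a,c} = x^{r(a)}`; the lowest-order term of the determinant is selected by a MIN-COST ASSIGNMENT between rows and column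
groups, and LP duality hands out integer POTENTIALS `α_i` (rows), `β_j` (columns) with `α_i + val(i,j) ≥ β_j`, tight exactly on the
optimal («leading») entries.  Scaling row `i` by `X^{α_i}` and column `j` by `X^{−β_j}` turns the matrix into a polynomial matrix `N`
whose value at `X = 0` is the LEADING MATRIX `M̂` (the mixed instance of the next level of the certificate).  This file packages the
conclusion, two-sided (the one-sided row version is `…ChowBenchmarkPairsLeadingTerm.det_eq_X_pow_mul_of_rows`):

* `det_scaled_eq` — if `X^{α i} · M i j = N i j · X^{β j}` for all `i, j` then `X^{Σ α} · det M = det N · X^{Σ β}`;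
* **`det_ne_zero_of_potentials`** — if moreover `det N(0) ≠ 0` then `det M ≠ 0` in `R[X]`;
* `finite_eval_det_eq_zero` / `exists_eval_det_ne_zero` — hence `det M(x) ≠ 0` for all but finitely many / some `x ∈ R` (`R` infinite).

WHAT THIS IS NOT: bookkeeping only; nothing on crux stmt-ValiantsHypothesis-14610 or on `VP` versus `VNP`.
-/

set_option linter.dupNamespace false

namespace Summit.ValiantsHypothesis.ValiantsHypothesis.Theorems.BarrierLever.ChowBenchmarkSplitLeading

open Polynomial

variable {R : Type*} [CommRing R] {n : Type*} [Fintype n] [DecidableEq n]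

/-- Two-sided monomial scaling: `X^{α i} M i j = N i j X^{β j}` for all entries gives `X^{Σα} det M = det N · X^{Σβ}`. -/
theorem det_scaled_eq (M N : Matrix n n R[X]) (α β : n → ℕ)
    (h : ∀ i j, (X : R[X]) ^ α i * M i j = N i j * (X : R[X]) ^ β j) :
    (X : R[X]) ^ (∑ i, α i) * M.det = N.det * (X : R[X]) ^ (∑ j, β j) := by
  have h1 : (Matrix.of fun i j => (X : R[X]) ^ α i * M i j).det = (∏ i, (X : R[X]) ^ α i) * M.det :=
    Matrix.det_mul_column (fun i => (X : R[X]) ^ α i) M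
  have h2 : (Matrix.of fun i j => N i j * (X : R[X]) ^ β j).det = (∏ j, (X : R[X]) ^ β j) * N.det := by
    have := Matrix.det_mul_row (fun j => (X : R[X]) ^ β j) N
    rw [← this]
    congr 1
    ext i j
    rw [Matrix.of_apply, Matrix.of_apply, mul_comm]
  have h3 : (Matrix.of fun i j => (X : R[X]) ^ α i * M i j) = Matrix.of fun i j => N i j * (X : R[X]) ^ β j := by
    ext i j
    rw [Matrix.of_apply, Matrix.of_apply, h i j]
  rw [← Finset.prod_pow_eq_pow_sum, ← Finset.prod_pow_eq_pow_sum, ← h1, h3, h2, mul_comm]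

/-- Evaluating a determinant entrywise. -/
theorem eval_det (M : Matrix n n R[X]) (x : R) : M.det.eval x = (Matrix.of fun i j => (M i j).eval x).det := by
  have h := RingHom.map_det (Polynomial.evalRingHom x) M
  rw [Polynomial.coe_evalRingHom] at h
  rw [h]
  rfl

variable [IsDomain R]

/-- **THE POTENTIAL LEMMA.**  If `X^{α i} M i j = N i j X^{β j}` for all entries (row potentials `α`, column potentials `β`,
`N` a polynomial matrix) and the leading matrix `N(0)` is nonsingular, then `det M ≠ 0` in `R[X]`. -/
theorem det_ne_zero_of_potentials (M N : Matrix n n R[X]) (α β : n → ℕ)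
    (h : ∀ i j, (X : R[X]) ^ α i * M i j = N i j * (X : R[X]) ^ β j)
    (hN : (Matrix.of fun i j => (N i j).eval 0).det ≠ 0) : M.det ≠ 0 := by
  intro hM
  have hs := det_scaled_eq M N α β h
  rw [hM, mul_zero] at hs
  have hNdet : N.det = 0 := by
    rcases mul_eq_zero.mp hs.symm with h0 | h0
    · exact h0
    · exact absurd h0 (pow_ne_zero _ Polynomial.X_ne_zero)
  apply hN
  rw [← eval_det, hNdet, eval_zero]

/-- **Cofinite form**: under the potential lemma's hypotheses, `det M(x) = 0` for only finitely many `x`. -/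
theorem finite_eval_det_eq_zero (M N : Matrix n n R[X]) (α β : n → ℕ)
    (h : ∀ i j, (X : R[X]) ^ α i * M i j = N i j * (X : R[X]) ^ β j)
    (hN : (Matrix.of fun i j => (N i j).eval 0).det ≠ 0) :
    Set.Finite {x : R | (Matrix.of fun i j => (M i j).eval x).det = 0} := by
  have hne := det_ne_zero_of_potentials M N α β h hN
  refine (Polynomial.finite_setOf_isRoot hne).subset fun x hx => ?_
  rw [Set.mem_setOf_eq, Polynomial.IsRoot.def, eval_det]
  exact hx

/-- **Existence form** (`R` an infinite domain, e.g. `ℂ`): some `x` makes `det M(x) ≠ 0`. -/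
theorem exists_eval_det_ne_zero [Infinite R] (M N : Matrix n n R[X]) (α β : n → ℕ)
    (h : ∀ i j, (X : R[X]) ^ α i * M i j = N i j * (X : R[X]) ^ β j)
    (hN : (Matrix.of fun i j => (N i j).eval 0).det ≠ 0) :
    ∃ x : R, (Matrix.of fun i j => (M i j).eval x).det ≠ 0 := by
  obtain ⟨x, hx⟩ := Set.Infinite.nonempty (Set.Finite.infinite_compl (finite_eval_det_eq_zero M N α β h hN))
  exact ⟨x, hx⟩

end Summit.ValiantsHypothesis.ValiantsHypothesis.Theorems.BarrierLever.ChowBenchmarkSplitLeading
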